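import Summits.CriticalPhenomena.Ising3DConformalLimit.Theorems.FKParityRobustnessSourceTrailsMeet
import Summits.CriticalPhenomena.Ising3DConformalLimit.Theorems.FKFourConnectivity.Negative.LatticeNecessity
import Literature.Probability.Percolation.SiteConnectionTools
import Literature.Probability.LatticeModels.ModifiedSimonInequality
import Literature.Probability.LatticeModels.RandomCurrentsProofs
import Literature.Probability.LatticeModels.UrsellFourCurrents
import Literature.Probability.LatticeModels.AizenmanGrahamInequality
import HarnessLib

/-!
# `SourceTrailsMeet` (stmt-CriticalPhenomena-11255): the logical square closes, I —
# `SourceTrailsMeet → ParityRobustMerging` and `SourceTrailsMeet → LoopJoinBound`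

Route `FKParityRobustness`, sub-problem `Ising3DConformalLimit`.  Seat 0 of this item landed
`ParityRobustMerging ∧ FKFourConnectivity → SourceTrailsMeet → FKFourConnectivity` and
`LoopJoinBound → SourceTrailsMeet` (`FKParityRobustnessSourceTrailsMeet.lean`, `…Rungs.lean`).  The two
missing arrows, `SourceTrailsMeet → ParityRobustMerging` and `SourceTrailsMeet → LoopJoinBound`, need one
lattice input beyond the finite-graph dictionary: the **tetrahedral symmetry** of the sources
`A_l = l·{(−1,−1,−1),(1,1,−1),(1,−1,1),(−1,1,1)}` in the centred box `Λ_N = {−N,…,N}³` — the coordinate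
transpositions `y ↔ z` and `x ↔ z` are lattice automorphisms preserving the box and permuting `A_l`, so
all six two-point functions `⟨σ_{aᵢ}σ_{aⱼ}⟩^free_{Λ_N}` coincide (`isingTwoPoint_tetra_pairs_eq`) — and
Lebowitz' inequality `U₄ ≤ 0`.  Proved here:

* `hteSum_univ_eq_sum_tJoins`, `nPoint_free_eq_zMass_div`, `isingTwoPoint_free_eq_pairMass_div` : the
  high-temperature dictionary `⟨σ_A⟩^free_G = Z_t(A)/Z_t(∅)` on the whole vertex set of a finite graph;
* `zMass_mul_loopEmpty_le_sum_pairs` : Lebowitz in loop dress, `Z(A)Z(∅) ≤ Σ_π Z({aᵢ,aⱼ})Z({aₖ,aₗ})`;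
* `isingTwoPoint_box_signedPerm`, `isingTwoPoint_tetra_pairs_eq` : the symmetry;
* `allJoined_le_three_mul_pairProduct` : `φ_N[A_l all joined] ≤ 3·φ_N[a₀↔a₁]φ_N[a₂↔a₃]` (FK ceiling);
* `zMass_mul_loopEmpty_le_three_mul_pairs` : `Z(A_l)·Z(∅) ≤ 3·Z({a₀,a₁})·Z({a₂,a₃})` (loop ceiling);
* `parityRobustMerging_of_sourceTrailsMeet` : `SourceTrailsMeet → ParityRobustMerging` (constant `c/3`),
  and its contrapositive `not_sourceTrailsMeet_of_not_parityRobustMerging` (the item's kill switch);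
* `loopJoinBound_of_sourceTrailsMeet` : `SourceTrailsMeet →` the loop-side join bound
  `(c/3)·Z(A_l) ≤ Z(A_l; all aᵢ in one component of F)`, i.e. `ℓ^{A_l}_N[F joins A_l] ≥ c/3` uniformly in
  `l` — the Monte-Carlo observable of the crux campaign on `ParityRobustMerging`.

With seat 0's arrows the item is therefore EXACTLY the conjunction of the two cruxes
`ParityRobustMerging ∧ FKFourConnectivity` (stmt-…-11253 ∧ stmt-…-11254) and exactly the loop join bound
(the `↔` statements are in part II, `…SquareIff.lean`): a refutation of either crux refutes it, a proof
of both proves it; its status is theirs (open; predicted false by the watermelon exponent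
`x₄(N→1) ≈ 3.25 > 3`).  Theorem-only file.  References: J. L. Lebowitz, Comm. Math. Phys. 35 (1974) 87
[Lebowitz1974]; G. Grimmett, S. Janson, arXiv:0709.3039, Thm 3.1 [GrimmettJanson2007]; S. Friedli,
Y. Velenik, *Statistical Mechanics of Lattice Systems* (2017), §3.1 and Exercise 3.14
[FriedliVelenik2017]; H. Duminil-Copin, *Lectures on the Ising and Potts models on the hypercubic
lattice* (2017), §2.2.1 [DuminilCopinECM2018].
-/

noncomputable section

open MeasureTheory Finset SimpleGraph
open Literature.Probability.LatticeModels
open Literature.Probability.Percolation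
open Summit.CriticalPhenomena.Ising3DConformalLimit.Cruxes.ParityRobustMerging.PlaquetteXorSurgery

namespace Summit.CriticalPhenomena.Ising3DConformalLimit.Theorems

open scoped Classical

/-! ### Finite graphs: the high-temperature dictionary and Lebowitz in loop dress -/

section General

variable {V : Type*} [Fintype V] [DecidableEq V] (G : SimpleGraph V) [DecidableRel G.Adj]

/-- On the whole vertex set the high-temperature generating sum of `ModifiedSimonInequality` is the
sourced loop-O(1) mass of the `T`-joins: `g_{univ}(S) = Σ_{F ∈ 𝒯_S(G)} t^{|F|}`
(Duminil-Copin 2017, §2.2.1). [cite: DuminilCopinECM2018, §2.2.1 (high-temperature expansion)] -/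
theorem hteSum_univ_eq_sum_tJoins (t : ℝ) (S : Finset V) :
    hteSum G univ t S = ∑ F ∈ tJoins G Set.univ S, t ^ #F := by
  unfold hteSum
  refine Finset.sum_congr ?_ fun _ _ => rfl
  ext F
  simp only [Finset.mem_filter, Finset.mem_powerset, mem_tJoins, edgesIn_univ, Set.subset_univ,
    true_and, oddVerts, Finset.ext_iff, Finset.mem_univ]

/-- **High-temperature expansion of the four-point function**: for four distinct vertices,
`⟨σ_{a₀}σ_{a₁}σ_{a₂}σ_{a₃}⟩^free_G = Z_t(A)/Z_t(∅)`, `t = tanh β`, `Z_t(A)` the loop-O(1) mass of the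
`T`-joins of `A = {aᵢ}` (Duminil-Copin 2017, §2.2.1). [cite: DuminilCopinECM2018, §2.2.1 (high-temperature expansion)] -/
theorem nPoint_free_eq_zMass_div (β : ℝ) (a : Fin 4 → V) (ha : Function.Injective a) :
    nPoint (isingMeasure G univ β 0 .free) spinAt a =
      zMass G (Real.tanh β) a (fun _ => True) / loopO1PartitionFunction G (Real.tanh β) ∅ := by
  have h1 : nPoint (isingMeasure G univ β 0 .free) spinAt a = isingCorr G univ β 0 .free (univ.image a) := by
    rw [nPoint_isingMeasure, isingCorr]
    congr 1
    funext s
    unfold spinMonomial spinProduct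
    rw [Finset.prod_image fun i _ j _ h => ha h]
  rw [h1, isingCorr_free_eq_hteSum_div G univ β (Finset.subset_univ _), hteSum_univ_eq_sum_tJoins,
    hteSum_univ_eq_sum_tJoins, ← loopO1PartitionFunction_eq_sum_tJoins G (Real.tanh β) ∅, zMass,
    Finset.filter_true]

/-- **The two-point function in loop dress**: `⟨σ_xσ_y⟩^free_G = Z_t({x,y})/Z_t(∅)` for `x ≠ y`,
`β ≥ 0` (Edwards–Sokal and the Grimmett–Janson dictionary `rcMeasure_real_openConn_eq`).
[cite: GrimmettJanson2007, Thm 3.1] -/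
theorem isingTwoPoint_free_eq_pairMass_div {β : ℝ} (hβ : 0 ≤ β) {x y : V} (hxy : x ≠ y) :
    isingTwoPoint G univ β 0 .free x y =
      (∑ F ∈ tJoins G Set.univ {x, y}, Real.tanh β ^ #F) / loopO1PartitionFunction G (Real.tanh β) ∅ := by
  rw [edwardsSokal_twoPoint_holds G hβ x y]
  exact rcMeasure_real_openConn_eq G hβ hxy

/-- **Lebowitz' inequality in loop dress** (Lebowitz 1974; Aizenman 1982 Prop. 5.2): for four distinct
vertices of a finite graph and `t = tanh β`, `β ≥ 0`,
`Z_t(A)·Z_t(∅) ≤ Z({a₀,a₁})Z({a₂,a₃}) + Z({a₀,a₂})Z({a₁,a₃}) + Z({a₀,a₃})Z({a₁,a₂})` — `U₄ ≤ 0`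
(`lebowitz_holds`) multiplied by `Z_t(∅)²`, through the high-temperature dictionary.
[cite: Lebowitz1974, Theorem, eq. (2.5b)] -/
theorem zMass_mul_loopEmpty_le_sum_pairs {β : ℝ} (hβ : 0 ≤ β) (a : Fin 4 → V)
    (ha : Function.Injective a) :
    zMass G (Real.tanh β) a (fun _ => True) * loopO1PartitionFunction G (Real.tanh β) ∅ ≤
      (∑ F ∈ tJoins G Set.univ {a 0, a 1}, Real.tanh β ^ #F) *
          (∑ F ∈ tJoins G Set.univ {a 2, a 3}, Real.tanh β ^ #F) +
        (∑ F ∈ tJoins G Set.univ {a 0, a 2}, Real.tanh β ^ #F) *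
          (∑ F ∈ tJoins G Set.univ {a 1, a 3}, Real.tanh β ^ #F) +
        (∑ F ∈ tJoins G Set.univ {a 0, a 3}, Real.tanh β ^ #F) *
          (∑ F ∈ tJoins G Set.univ {a 1, a 2}, Real.tanh β ^ #F) := by
  set Z0 : ℝ := loopO1PartitionFunction G (Real.tanh β) ∅ with hZ0_def
  set ZA : ℝ := zMass G (Real.tanh β) a (fun _ => True) with hZA_def
  set Z01 : ℝ := ∑ F ∈ tJoins G Set.univ {a 0, a 1}, Real.tanh β ^ #F with h01
  set Z23 : ℝ := ∑ F ∈ tJoins G Set.univ {a 2, a 3}, Real.tanh β ^ #F with h23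
  set Z02 : ℝ := ∑ F ∈ tJoins G Set.univ {a 0, a 2}, Real.tanh β ^ #F with h02
  set Z13 : ℝ := ∑ F ∈ tJoins G Set.univ {a 1, a 3}, Real.tanh β ^ #F with h13
  set Z03 : ℝ := ∑ F ∈ tJoins G Set.univ {a 0, a 3}, Real.tanh β ^ #F with h03
  set Z12 : ℝ := ∑ F ∈ tJoins G Set.univ {a 1, a 2}, Real.tanh β ^ #F with h12
  have hZ0 : 0 < Z0 := loopO1PartitionFunction_tanh_empty_pos G hβ
  have hleb := lebowitz_holds G hβ univ a (fun _ => Finset.mem_univ _)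
  simp only [connectedFour, twoPoint_isingMeasure] at hleb
  rw [nPoint_free_eq_zMass_div G β a ha,
    isingTwoPoint_free_eq_pairMass_div G hβ (ha.ne (by decide : (0 : Fin 4) ≠ 1)),
    isingTwoPoint_free_eq_pairMass_div G hβ (ha.ne (by decide : (2 : Fin 4) ≠ 3)),
    isingTwoPoint_free_eq_pairMass_div G hβ (ha.ne (by decide : (0 : Fin 4) ≠ 2)),
    isingTwoPoint_free_eq_pairMass_div G hβ (ha.ne (by decide : (1 : Fin 4) ≠ 3)),
    isingTwoPoint_free_eq_pairMass_div G hβ (ha.ne (by decide : (0 : Fin 4) ≠ 3)),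
    isingTwoPoint_free_eq_pairMass_div G hβ (ha.ne (by decide : (1 : Fin 4) ≠ 2))] at hleb
  rw [← hZ0_def, ← hZA_def, ← h01, ← h23, ← h02, ← h13, ← h03, ← h12] at hleb
  have h1 : ZA / Z0 ≤ Z01 / Z0 * (Z23 / Z0) + Z02 / Z0 * (Z13 / Z0) + Z03 / Z0 * (Z12 / Z0) := by
    linarith
  rw [← mul_div_mul_right ZA Z0 hZ0.ne', div_mul_div_comm, div_mul_div_comm, div_mul_div_comm,
    ← add_div, ← add_div, div_le_div_iff_of_pos_right (mul_pos hZ0 hZ0)] at h1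
  exact h1

end General

/-! ### The tetrahedral symmetry of the sources in the centred box -/

section Symmetry

/-- Coordinate permutations map the centred box `Λ_N = {−N,…,N}³` onto itself. [folklore] -/
theorem box_map_signedPerm (π : Equiv.Perm (Fin 3)) (N : ℕ) :
    (box 3 N).map (Site.signedPerm π 1).toEmbedding = box 3 N := by
  ext x
  rw [Finset.mem_map_equiv, Site.signedPerm_symm]
  exact signedPerm_mem_box_iff π.symm _

/-- **Invariance of the free-box two-point function under coordinate permutations**
(Friedli–Velenik 2017, Exercise 3.14: a lattice symmetry preserving `Λ` preserves `⟨·⟩^free_Λ`):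
`⟨σ_{πx}σ_{πy}⟩^free_{Λ_N} = ⟨σ_xσ_y⟩^free_{Λ_N}`. [cite: FriedliVelenik2017, Exercise 3.14, p. 115] -/
theorem isingTwoPoint_box_signedPerm (π : Equiv.Perm (Fin 3)) (N : ℕ) (β : ℝ) (x y : Site 3) :
    isingTwoPoint (zdGraph 3) (box 3 N) β 0 .free (Site.signedPerm π 1 x) (Site.signedPerm π 1 y) =
      isingTwoPoint (zdGraph 3) (box 3 N) β 0 .free x y := by
  have hadj : ∀ x ∈ box 3 N, ∀ y ∈ box 3 N,
      ((zdGraph 3).Adj ((Site.signedPerm π 1).toEmbedding x) ((Site.signedPerm π 1).toEmbedding y) ↔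
        (zdGraph 3).Adj x y) :=
    fun x _ y _ => (zdSignedPermIso π (1 : Fin 3 → ℤˣ)).map_adj_iff
  have h := isingTwoPoint_free_map (G := zdGraph 3) (G' := zdGraph 3) (Site.signedPerm π 1).toEmbedding
    (Λ := box 3 N) hadj β 0 x y
  rw [box_map_signedPerm] at h
  exact h

/-- Coordinate permutations commute with dilations. [folklore] -/
theorem signedPerm_one_smul (π : Equiv.Perm (Fin 3)) (l : ℤ) (x : Site 3) :
    Site.signedPerm π 1 (l • x) = l • Site.signedPerm π 1 x := by
  funext i
  simp [Site.signedPerm_apply]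

/-- The transposition `y ↔ z` fixes `tetra 0`, `tetra 3` and swaps `tetra 1 ↔ tetra 2`. [folklore] -/
theorem signedPerm_swap12_tetra :
    Site.signedPerm (Equiv.swap 1 2) 1 (tetra 0) = tetra 0 ∧
      Site.signedPerm (Equiv.swap 1 2) 1 (tetra 1) = tetra 2 ∧
      Site.signedPerm (Equiv.swap 1 2) 1 (tetra 2) = tetra 1 ∧
      Site.signedPerm (Equiv.swap 1 2) 1 (tetra 3) = tetra 3 := by
  unfold tetra
  refine ⟨?_, ?_, ?_, ?_⟩ <;> funext i <;> fin_cases i <;>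
    simp [Site.signedPerm_apply, Equiv.swap_apply_def]

/-- The transposition `x ↔ z` fixes `tetra 0`, `tetra 2` and swaps `tetra 1 ↔ tetra 3`. [folklore] -/
theorem signedPerm_swap02_tetra :
    Site.signedPerm (Equiv.swap 0 2) 1 (tetra 0) = tetra 0 ∧
      Site.signedPerm (Equiv.swap 0 2) 1 (tetra 1) = tetra 3 ∧
      Site.signedPerm (Equiv.swap 0 2) 1 (tetra 2) = tetra 2 ∧
      Site.signedPerm (Equiv.swap 0 2) 1 (tetra 3) = tetra 1 := by
  unfold tetra
  refine ⟨?_, ?_, ?_, ?_⟩ <;> funext i <;> fin_cases i <;>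
    simp [Site.signedPerm_apply, Equiv.swap_apply_def]

/-- **All six critical two-point functions of the tetrahedron coincide** (cubic symmetry of
`(Λ_N, A_l)`): for `a = l·tetra ⊂ Λ_N` and the free Ising model of the box graph at any `β`,
`⟨σ_{a₀}σ_{a₂}⟩ = ⟨σ_{a₀}σ_{a₁}⟩`, `⟨σ_{a₁}σ_{a₃}⟩ = ⟨σ_{a₂}σ_{a₃}⟩`, `⟨σ_{a₀}σ_{a₃}⟩ = ⟨σ_{a₀}σ_{a₁}⟩`,
`⟨σ_{a₁}σ_{a₂}⟩ = ⟨σ_{a₂}σ_{a₃}⟩` (transport along `val`, `isingTwoPoint_boxGraph`, then the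
transpositions `y ↔ z`, `x ↔ z`). [cite: FriedliVelenik2017, Exercise 3.14, p. 115] -/
theorem isingTwoPoint_tetra_pairs_eq {l N : ℕ} (a : Fin 4 → ↥(box 3 N))
    (ha : ∀ i, ((a i : Site 3)) = (l : ℤ) • tetra i) (β : ℝ) :
    isingTwoPoint (boxGraph N) univ β 0 .free (a 0) (a 2) = isingTwoPoint (boxGraph N) univ β 0 .free (a 0) (a 1) ∧
    isingTwoPoint (boxGraph N) univ β 0 .free (a 1) (a 3) = isingTwoPoint (boxGraph N) univ β 0 .free (a 2) (a 3) ∧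
    isingTwoPoint (boxGraph N) univ β 0 .free (a 0) (a 3) = isingTwoPoint (boxGraph N) univ β 0 .free (a 0) (a 1) ∧
    isingTwoPoint (boxGraph N) univ β 0 .free (a 1) (a 2) = isingTwoPoint (boxGraph N) univ β 0 .free (a 2) (a 3) := by
  obtain ⟨s0, s1, s2, s3⟩ := signedPerm_swap12_tetra
  obtain ⟨r0, r1, r2, r3⟩ := signedPerm_swap02_tetra
  -- images of the sources under the two transpositions
  have e0 : Site.signedPerm (Equiv.swap 1 2) 1 (a 0 : Site 3) = (a 0 : Site 3) := by
    rw [ha 0, signedPerm_one_smul, s0]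
  have e1 : Site.signedPerm (Equiv.swap 1 2) 1 (a 1 : Site 3) = (a 2 : Site 3) := by
    rw [ha 1, signedPerm_one_smul, s1, ha 2]
  have e3 : Site.signedPerm (Equiv.swap 1 2) 1 (a 3 : Site 3) = (a 3 : Site 3) := by
    rw [ha 3, signedPerm_one_smul, s3]
  have f0 : Site.signedPerm (Equiv.swap 0 2) 1 (a 0 : Site 3) = (a 0 : Site 3) := by
    rw [ha 0, signedPerm_one_smul, r0]
  have f1 : Site.signedPerm (Equiv.swap 0 2) 1 (a 1 : Site 3) = (a 3 : Site 3) := by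
    rw [ha 1, signedPerm_one_smul, r1, ha 3]
  have f2 : Site.signedPerm (Equiv.swap 0 2) 1 (a 2 : Site 3) = (a 2 : Site 3) := by
    rw [ha 2, signedPerm_one_smul, r2]
  have T : ∀ x y : ↥(box 3 N), isingTwoPoint (boxGraph N) univ β 0 .free x y =
      isingTwoPoint (zdGraph 3) (box 3 N) β 0 .free (x : Site 3) (y : Site 3) :=
    fun x y => FKFourConnectivity.Negative.isingTwoPoint_boxGraph N β x y
  refine ⟨?_, ?_, ?_, ?_⟩
  · rw [T, T, ← isingTwoPoint_box_signedPerm (Equiv.swap 1 2) N β (a 0 : Site 3) (a 1 : Site 3), e0, e1]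
  · rw [T, T, ← isingTwoPoint_box_signedPerm (Equiv.swap 1 2) N β (a 1 : Site 3) (a 3 : Site 3), e1, e3]
  · rw [T, T, ← isingTwoPoint_box_signedPerm (Equiv.swap 0 2) N β (a 0 : Site 3) (a 1 : Site 3), f0, f1]
  · rw [T, T, isingTwoPoint_symm (zdGraph 3) (box 3 N) β 0 .free (a 1 : Site 3) (a 2 : Site 3),
      ← isingTwoPoint_box_signedPerm (Equiv.swap 0 2) N β (a 2 : Site 3) (a 1 : Site 3), f2, f1]

/-- **FK ceiling with the tetrahedral symmetry**: `φ_N[A_l all joined] ≤ 3·φ_N[a₀↔a₁]·φ_N[a₂↔a₃]` for the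
free FK-Ising measure of the box graph at any `β ≥ 0` — the Lebowitz ceiling
`φ(ALL) ≤ Σ_π φ(aᵢ↔aⱼ)φ(aₖ↔aₗ)` (`allJoined_le_sum_pairProducts`) in which, by Edwards–Sokal and
`isingTwoPoint_tetra_pairs_eq`, the three pairing products coincide. [cite: Lebowitz1974, Theorem, eq. (2.5b)] -/
theorem allJoined_le_three_mul_pairProduct {l N : ℕ} (a : Fin 4 → ↥(box 3 N))
    (ha : ∀ i, ((a i : Site 3)) = (l : ℤ) • tetra i) {β : ℝ} (hβ : 0 ≤ β) :
    (rcMeasure (boxGraph N) (fkIsingParam β) 2 ∅).real {ω | ∀ i j, (openGraph ω).Reachable (a i) (a j)} ≤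
      3 * ((rcMeasure (boxGraph N) (fkIsingParam β) 2 ∅).real (openConn (a 0) (a 1)) *
        (rcMeasure (boxGraph N) (fkIsingParam β) 2 ∅).real (openConn (a 2) (a 3))) := by
  have h := FKFourConnectivity.Negative.allJoined_le_sum_pairProducts (boxGraph N) hβ a
  have hES : ∀ x y : ↥(box 3 N), (rcMeasure (boxGraph N) (fkIsingParam β) 2 ∅).real (openConn x y) =
      isingTwoPoint (boxGraph N) univ β 0 .free x y := fun x y => (edwardsSokal_twoPoint_holds _ hβ x y).symm
  obtain ⟨q02, q13, q03, q12⟩ := isingTwoPoint_tetra_pairs_eq a ha β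
  rw [hES, hES, hES, hES, hES, hES, q02, q13, q03, q12] at h
  rw [hES, hES]
  linarith

/-- **Loop ceiling with the tetrahedral symmetry**: `Z(A_l)·Z(∅) ≤ 3·Z({a₀,a₁})·Z({a₂,a₃})` for the
critical (indeed any `β ≥ 0`) loop-O(1) masses of the box graph, `l ≥ 1` — Lebowitz in loop dress
(`zMass_mul_loopEmpty_le_sum_pairs`) with the three pairing products identified through
`⟨σ_xσ_y⟩ = Z({x,y})/Z(∅)` and `isingTwoPoint_tetra_pairs_eq`. [cite: Lebowitz1974, Theorem, eq. (2.5b)] -/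
theorem zMass_mul_loopEmpty_le_three_mul_pairs {l N : ℕ} (hl : 1 ≤ l) (a : Fin 4 → ↥(box 3 N))
    (ha : ∀ i, ((a i : Site 3)) = (l : ℤ) • tetra i) {β : ℝ} (hβ : 0 ≤ β) :
    zMass (boxGraph N) (Real.tanh β) a (fun _ => True) * loopO1PartitionFunction (boxGraph N) (Real.tanh β) ∅ ≤
      3 * ((∑ F ∈ tJoins (boxGraph N) Set.univ {a 0, a 1}, Real.tanh β ^ #F) *
        (∑ F ∈ tJoins (boxGraph N) Set.univ {a 2, a 3}, Real.tanh β ^ #F)) := by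
  have hainj : Function.Injective a := tetra_injective hl a ha
  have hZ0 : 0 < loopO1PartitionFunction (boxGraph N) (Real.tanh β) ∅ :=
    loopO1PartitionFunction_tanh_empty_pos _ hβ
  have h := zMass_mul_loopEmpty_le_sum_pairs (boxGraph N) hβ a hainj
  -- each pair mass is `⟨σσ⟩ · Z(∅)`
  have hP : ∀ {i j : Fin 4}, i ≠ j → (∑ F ∈ tJoins (boxGraph N) Set.univ {a i, a j}, Real.tanh β ^ #F) =
      isingTwoPoint (boxGraph N) univ β 0 .free (a i) (a j) * loopO1PartitionFunction (boxGraph N) (Real.tanh β) ∅ := by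
    intro i j hij
    rw [isingTwoPoint_free_eq_pairMass_div (boxGraph N) hβ (hainj.ne hij), div_mul_cancel₀ _ hZ0.ne']
  obtain ⟨q02, q13, q03, q12⟩ := isingTwoPoint_tetra_pairs_eq a ha β
  rw [hP (by decide : (0 : Fin 4) ≠ 1), hP (by decide : (2 : Fin 4) ≠ 3), hP (by decide : (0 : Fin 4) ≠ 2),
    hP (by decide : (1 : Fin 4) ≠ 3), hP (by decide : (0 : Fin 4) ≠ 3), hP (by decide : (1 : Fin 4) ≠ 2),
    q02, q13, q03, q12] at h
  rw [hP (by decide : (0 : Fin 4) ≠ 1), hP (by decide : (2 : Fin 4) ≠ 3)]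
  linarith

end Symmetry

/-! ### The square closes -/

section Square

open Summit.CriticalPhenomena.Ising3DConformalLimit.Theses.FKParityRobustness

/-- **`SourceTrailsMeet → ParityRobustMerging`** (constant `c/3`, same `N₀(l)`): from the merged FK
form `c·φ[a₀↔a₁]φ[a₂↔a₃] ≤ ∫ u_a dφ` of the item (`sourceTrailsMeet_iff_fkMerged`) and the ceiling
`φ[all joined] ≤ 3φ[a₀↔a₁]φ[a₂↔a₃]` (`allJoined_le_three_mul_pairProduct`).  With seat 0's
`fkFourConnectivity_of_sourceTrailsMeet` and `sourceTrailsMeet_of_parityRobustMerging_of_fkFourConnectivity`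
this makes the item the conjunction of the two cruxes. [cite: Lebowitz1974, Theorem, eq. (2.5b)] -/
theorem parityRobustMerging_of_sourceTrailsMeet : SourceTrailsMeet → ParityRobustMerging := by
  intro hS
  rw [sourceTrailsMeet_iff_fkMerged] at hS
  unfold ParityRobustMerging
  intro tetra
  obtain ⟨c, hc, hS⟩ := hS
  refine ⟨c / 3, by positivity, fun l hl => ?_⟩
  obtain ⟨N₀, hS⟩ := hS l hl
  refine ⟨N₀, fun N hN a ha => ?_⟩
  have hβ : 0 ≤ criticalBeta 3 := criticalBeta_nonneg 3
  have hS := hS N hN a ha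
  intro G φ sol u
  have hS' : c * φ.real (openConn (a 0) (a 1)) * φ.real (openConn (a 2) (a 3)) ≤ ∫ ω, u ω ∂φ := hS
  have h3 : φ.real {ω | ∀ i j, (openGraph ω).Reachable (a i) (a j)} ≤
      3 * (φ.real (openConn (a 0) (a 1)) * φ.real (openConn (a 2) (a 3))) :=
    allJoined_le_three_mul_pairProduct a ha hβ
  calc c / 3 * φ.real {ω | ∀ i j, (openGraph ω).Reachable (a i) (a j)}
      ≤ c / 3 * (3 * (φ.real (openConn (a 0) (a 1)) * φ.real (openConn (a 2) (a 3)))) :=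
        mul_le_mul_of_nonneg_left h3 (by positivity)
    _ = c * φ.real (openConn (a 0) (a 1)) * φ.real (openConn (a 2) (a 3)) := by ring
    _ ≤ ∫ ω, u ω ∂φ := hS'

/-- **Kill switches of the item**: a refutation of the crux `ParityRobustMerging`
(stmt-CriticalPhenomena-11253, predicted false by the route: watermelon exponent `x₄(N→1) ≈ 3.25 > 3`)
refutes `SourceTrailsMeet` (contrapositive of `parityRobustMerging_of_sourceTrailsMeet`). [cite: Lebowitz1974, Theorem, eq. (2.5b)] -/
theorem not_sourceTrailsMeet_of_not_parityRobustMerging : ¬ParityRobustMerging → ¬SourceTrailsMeet :=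
  fun hn hS => hn (parityRobustMerging_of_sourceTrailsMeet hS)

/-- **`SourceTrailsMeet` implies the loop-side join bound** (constant `c/3`): if
`c·Z({a₀,a₁})Z({a₂,a₃}) ≤ Z(∅)Z(A; all joined)` then, by the loop ceiling
`Z(A)Z(∅) ≤ 3Z({a₀,a₁})Z({a₂,a₃})` (`zMass_mul_loopEmpty_le_three_mul_pairs`) and `Z(∅) > 0`,
`(c/3)·Z(A) ≤ Z(A; all joined)`: the sourced loop-O(1) configuration with sources `A_l` keeps all four
sources in one component with `ℓ^{A_l}_N`-probability `≥ c/3`, uniformly in `l`. [cite: Lebowitz1974, Theorem, eq. (2.5b)] -/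
theorem loopJoinBound_of_sourceTrailsMeet : SourceTrailsMeet →
    (let tetra : Fin 4 → Literature.Probability.LatticeModels.Site 3 := ![![-1, -1, -1], ![1, 1, -1], ![1, -1, 1], ![-1, 1, 1]]; ∃ c : ℝ, 0 < c ∧ ∀ l : ℕ, 1 ≤ l → ∃ N₀ : ℕ, ∀ N : ℕ, N₀ ≤ N → ∀ a : Fin 4 → ↥(Literature.Probability.LatticeModels.box 3 N), (∀ i, ((a i : Literature.Probability.LatticeModels.Site 3)) = (l : ℤ) • tetra i) → c * zMass ((Literature.Probability.LatticeModels.zdGraph 3).comap (Subtype.val : ↥(Literature.Probability.LatticeModels.box 3 N) → Literature.Probability.LatticeModels.Site 3)) (Real.tanh (Literature.Probability.LatticeModels.criticalBeta 3)) a (fun _ => True) ≤ zMass ((Literature.Probability.LatticeModels.zdGraph 3).comap (Subtype.val : ↥(Literature.Probability.LatticeModels.box 3 N) → Literature.Probability.LatticeModels.Site 3)) (Real.tanh (Literature.Probability.LatticeModels.criticalBeta 3)) a (fun F => JoinsAll a F)) := by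
  intro hS
  unfold SourceTrailsMeet at hS
  intro tetra
  obtain ⟨c, hc, hS⟩ := hS
  refine ⟨c / 3, by positivity, fun l hl => ?_⟩
  obtain ⟨N₀, hS⟩ := hS l hl
  refine ⟨N₀, fun N hN a ha => ?_⟩
  have hβ : 0 ≤ criticalBeta 3 := criticalBeta_nonneg 3
  have hZ0 : 0 < loopO1PartitionFunction (boxGraph N) tc ∅ := loopO1PartitionFunction_tanh_empty_pos _ hβ
  have h := hS N hN a ha
  extract_lets E t Z at h
  have hZ : ∀ (S : Finset ↥(box 3 N)) (P : Finset (Sym2 ↥(box 3 N)) → Prop),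
      Z S P = ∑ F ∈ (tJoins (boxGraph N) Set.univ S).filter (fun F => P F), tc ^ #F := by
    intro S P
    simp only [Z, E, t]
    exact sum_powerset_filter_parity_eq _ _ S P
  rw [hZ, hZ, hZ, hZ, Finset.filter_true, Finset.filter_true, Finset.filter_true,
    ← loopO1PartitionFunction_eq_sum_tJoins (boxGraph N) tc ∅] at h
  -- `h : c * Z01 * Z23 ≤ Z0 * ZA(joined)`; the ceiling: `ZA * Z0 ≤ 3 * (Z01 * Z23)`
  have hceil := zMass_mul_loopEmpty_le_three_mul_pairs hl a ha hβ
  have hJ : zMass (boxGraph N) tc a (fun F => JoinsAll a F) =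
      ∑ F ∈ (tJoins (boxGraph N) Set.univ (univ.image a)).filter (fun F => JoinsAll a F), tc ^ #F := rfl
  have key : c / 3 * zMass (boxGraph N) tc a (fun _ => True) * loopO1PartitionFunction (boxGraph N) tc ∅ ≤
      zMass (boxGraph N) tc a (fun F => JoinsAll a F) * loopO1PartitionFunction (boxGraph N) tc ∅ :=
    calc c / 3 * zMass (boxGraph N) tc a (fun _ => True) * loopO1PartitionFunction (boxGraph N) tc ∅
        = c / 3 * (zMass (boxGraph N) tc a (fun _ => True) * loopO1PartitionFunction (boxGraph N) tc ∅) := by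
          ring
      _ ≤ c / 3 * (3 * ((∑ F ∈ tJoins (boxGraph N) Set.univ {a 0, a 1}, tc ^ #F) *
            (∑ F ∈ tJoins (boxGraph N) Set.univ {a 2, a 3}, tc ^ #F))) :=
          mul_le_mul_of_nonneg_left hceil (by positivity)
      _ = c * (∑ F ∈ tJoins (boxGraph N) Set.univ {a 0, a 1}, tc ^ #F) *
            (∑ F ∈ tJoins (boxGraph N) Set.univ {a 2, a 3}, tc ^ #F) := by ring
      _ ≤ loopO1PartitionFunction (boxGraph N) tc ∅ * zMass (boxGraph N) tc a (fun F => JoinsAll a F) := by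
          rw [hJ]; exact h
      _ = zMass (boxGraph N) tc a (fun F => JoinsAll a F) * loopO1PartitionFunction (boxGraph N) tc ∅ := by
          ring
  exact le_of_mul_le_mul_right key hZ0

end Square

end Summit.CriticalPhenomena.Ising3DConformalLimit.Theorems

end
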